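import Summits.HodgeConjecture.HodgeConjecture.Theorems.H413E2SWIdentityCloseFibreCM
import Summits.HodgeConjecture.HodgeConjecture.Theorems.H413E2SWDilateLetterCM
import Summits.HodgeConjecture.HodgeConjecture.Theorems.H413E2SWIdentityCloseTriplesAllFormulaCM
import Summits.HodgeConjecture.HodgeConjecture.Theorems.H413E2SWBorelBoundFrameUnip
import Literature.NumberTheory.Weil1965.ThetaIntegralHermNormSdForm
import HarnessLib

/-!
# H413 · E-2 · SW2 (iii) — I-CLOSE: `hfib` at the CM ∕ unitary datum ON THE FRAME OF RECORD (step (T5))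

Cell `hodgecm-mathlib`, crux H413 (`stmt-HodgeConjecture-24833`), child line `Cruxes/H413/Lines/F0_E2SiegelWeilWeilRange.lean` ED. 8,
stub `stub_SW2iii_siegelWeil`, identity half; F0P4-plan (g4) SOCKET MAP 2026-08-31T04:38:08Z («BOUND plugs at `hbd`»), RULING
05:19:54Z (1) («FORMULA FRAME for the TRIPLES») and A6 ARCHITECTURE OF RECORD 05:36:48Z.  KERNEL MATHEMATICS ONLY (no definition, no `sorry`).
HC_CM is proved only modulo the 7 printed citations until rung 0 closes.

WHAT THIS FILE DOES.  It discharges, inside ★ (T4) `E2SWIdentityCloseFibreCM.hfib_CM_of`, every binder that the tree already provides at the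
CM ∕ unitary datum, ON A4's FRAME OF RECORD `(u₀, jS, j, M)` and AT A SPLIT PLACE `v` (`sd ² = d` in `F_v`):
* `K := F_v`, `κ := Fin n` (`3 ≤ n` from `2 < N` and `e : Fin N × Fin 1 ≃ Fin n`), `𝕋 := doubledGramFin F (adelicGram F e TV TW)`;
* `Smat`, `hhS` ⟵ ★ `UnitaryDoubling.hNorm_eq_sdForm_C0` (A-p16): `hNorm = q_{C₀}`, `C₀ = reindex (gram ⊕ −d·gram⁻¹)`;
* the frame `(βv, fr, he1, he2)` WITH ITS FORMULA and the (T2a)-triples `H₁ H₂` for every `b` ⟵ ★ B-p02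
  `E2SWIdentityCloseTriplesAllFormulaCM.exists_frame_identityClose_triples_all₃` (given the (S-3E) nulls `hS3E`, A-p08's shape);
* the unipotent letter `hLN` ⟵ ★ A5 `E2SWBorelBoundFrameUnip.exists_lift_unipotent` (F0P4-p07);
* the Levi letter `hLD` ⟵ ★ (S-1) `E2SWDilateBoundCM.hLD_CM` (F0P4-p01), read on A-p01's formula frame ★ `exists_splitPlaceFrame₃`
  (given the one-place torus ideles `hIDL`, A-p01's (ζ) shape).
What remains as NAMED BINDERS is exactly: the frame of record `h2 hTW hW2 hTs u₀ hu₀ jS hjS j hj hM` (shared with A4∕A5∕A6∕`hLD_CM`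
VERBATIM), `E'' hE''` and (**)′ `hBOUND` (= the conclusion of ★ A4 `exists_borelBound_frame` ∕ A6 `exists_borelBound_CM`, per `Φ`), the
split place `hs`, a Haar measure `μK` on `F_v`, `hS3E` and `hIDL`.  The closed `hfib_CM` (the `hFIB` binder of ★
`E2SWSiegelWeilCM.siegelWeil_weilRange_CM_of_fib`) is this theorem with those binders discharged by name.

References: A. Weil, *Sur la formule de Siegel dans la théorie des groupes classiques*, Acta Math. 113 (1965), Chap. V n° 50 (39)–(40)
p. 74; Chap. VI n° 52 Théorème 5 pp. 76–77 [Weil1965]; A. Weil, *Sur certains groupes d'opérateurs unitaires*, Acta Math. 111 (1964),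
Chap. I n° 13 p. 160 [Weil1964]; J.-S. Li, J. reine angew. Math. 428 (1992), p. 181 [Li1992].
-/

set_option autoImplicit false
-- the cell's `Summit.HodgeConjecture.HodgeConjecture.…` namespace repeats the summit name by design (D-0017 layout)
set_option linter.dupNamespace false

noncomputable section

open MeasureTheory NumberField Filter Topology Set IsDedekindDomain
open scoped NNReal ENNReal Matrix ComplexConjugate ComplexOrder
open Literature.NumberTheory.Automorphic Literature.NumberTheory.Automorphic.AdelicVector
open Literature.NumberTheory.Weil1964 Literature.NumberTheory.Weil1965 Literature.NumberTheory.Weil1965.UnitaryDoubling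
open Literature.NumberTheory.GaloisRepresentations.IsNonarchimedeanLocalField
open Literature.RepresentationTheory.HeisenbergGroup
open Literature.NumberTheory.Automorphic.DoubledUnitary.RankOneReduction
open Literature.NumberTheory.Automorphic.UnitaryGroup
open Literature.NumberTheory.Automorphic.UnitaryGroup.QuadraticCoordinates
open Literature.NumberTheory.GelbartRogawski1991 Literature.NumberTheory.GelbartRogawski1991.UnitaryDualPair
open Summit.HodgeConjecture.HodgeConjecture.Cruxes.H413
open Summit.HodgeConjecture.HodgeConjecture.Cruxes.H413.E2SWBorelBoundFrame

namespace Summit.HodgeConjecture.HodgeConjecture.Cruxes.H413.E2SWIdentityCloseFibreCMFrame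

section Main

variable (F E : Type) [Field F] [NumberField F] [Field E] [NumberField E] [Algebra F E] [Algebra.IsQuadraticExtension F E]
  (c : E ≃ₐ[F] E) {δ : E} (hcδ : c δ = -δ) (hδ : δ ≠ 0) {d : F} (hd : δ * δ = algebraMap F E d)
  (N : ℕ) {n : ℕ} (e : Fin N × Fin 1 ≃ Fin n)
  (TV : Matrix (Fin N) (Fin N) F) (hV : TV.IsSymm) (hVd : IsUnit TV.det)
  (TW : Matrix (Fin 1) (Fin 1) F) (hW : TW.IsSymm) (hWd : IsUnit TW.det)
  (hW2 : (Matrix.reindex finSumFinEquiv finSumFinEquiv (Matrix.fromBlocks TW 0 0 (-TW))).IsSymm)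
  [LocallyCompactSpace (UnitaryGroup.adelic F E c N (TV.map (algebraMap F E)))]
  [CompactSpace (UnitaryGroup.adelic F E c N (TV.map (algebraMap F E)) ⧸ (UnitaryGroup.toAdelic F E c N (TV.map (algebraMap F E))).range)]
  [MeasurableSpace (UnitaryGroup.adelic F E c N (TV.map (algebraMap F E)) ⧸ (UnitaryGroup.toAdelic F E c N (TV.map (algebraMap F E))).range)]
  [BorelSpace (UnitaryGroup.adelic F E c N (TV.map (algebraMap F E)) ⧸ (UnitaryGroup.toAdelic F E c N (TV.map (algebraMap F E))).range)]
  (ν : Measure (UnitaryGroup.adelic F E c N (TV.map (algebraMap F E)) ⧸ (UnitaryGroup.toAdelic F E c N (TV.map (algebraMap F E))).range))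
  [IsFiniteMeasure ν]
  [SMulInvariantMeasure (UnitaryGroup.adelic F E c N (TV.map (algebraMap F E)))
    (UnitaryGroup.adelic F E c N (TV.map (algebraMap F E)) ⧸ (UnitaryGroup.toAdelic F E c N (TV.map (algebraMap F E))).range) ν]
  [MeasurableSpace (adeleQuotient F)] [BorelSpace (adeleQuotient F)]
  [MeasurableSpace (AdeleRing (𝓞 F) F)] [BorelSpace (AdeleRing (𝓞 F) F)]
  (νX : Measure (Fin (n + n) → AdeleRing (𝓞 F) F)) [νX.IsAddHaarMeasure]
  (h : (Fin (n + n) → AdeleRing (𝓞 F) F) → AdeleRing (𝓞 F) F) (hh : Continuous h)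

include hδ in
/-- **(T5) `hfib_CM_of_frame` — THE FIBREWISE PROPORTIONALITY `∫ Θ dμ̂_b = ν(univ) · ∫ Θ dμ_b` AT THE CM ∕ UNITARY DATUM, ON A4's FRAME OF
RECORD AND AT A SPLIT PLACE.**  For every `b : F` and every nonnegative compactly supported `Θ ∈ 𝒮_ℝ(X□(𝔸))`, the theta-side fibre measure of
`Λ_θ,ℝ` along `h = hNorm` and Weil's `μ_b = E_X|_{h = b}` integrate `Θ` proportionally with the constant `ν(univ)`.  ★ (T4) `hfib_CM_of` with
`K := F_v`, `κ := Fin n`, `𝕋 := doubledGramFin (adelicGram)`, `Smat := ratMatrix C₀` and the letters `hhS` (★ `hNorm_eq_sdForm_C0`), frame +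
triples (★ `exists_frame_identityClose_triples_all₃`), `hLN` (★ `exists_lift_unipotent`), `hLD` (★ `hLD_CM` on ★ `exists_splitPlaceFrame₃`)
DISCHARGED; the named binders left are the frame of record (`h2 hTW hTs u₀ hu₀ jS hjS j hj hM`, VERBATIM as in ★ A4 ∕ A5 ∕ `hLD_CM`), `E'' hE''`,
(**)′ `hBOUND` (★ A4's conclusion per `Φ`), the split place `hs`, a Haar measure `μK` on `F_v`, the (S-3E) nulls `hS3E` (shape of ★ `_all₃`)
and the one-place torus ideles `hIDL` (shape of ★ `hLD_CM`).
[cite: Weil1965, Chap. V n° 50, (39)–(40), p. 74] [cite: Weil1965, Chap. VI n° 52, Théorème 5, pp. 76–77] [cite: Weil1964, Chap. I n° 13 p. 160] -/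
theorem hfib_CM_of_frame
    [IsTotallyReal F] [IsTotallyComplex E] (τ : E →+* ℂ) (hτ : ((TV.map (algebraMap F E)).map τ).PosDef) (hN : 2 < N)
    (hhN : ∀ x, h x = hNorm F E c hcδ hδ N e TV hVd TW hWd x)
    (hB : ∀ Φ ∈ piSchwartzBruhat F (Fin (n + n)), Summable fun ξ : F => ‖adelicSiegelCoeff F (Fin (n + n)) νX h Φ ξ‖)
    -- A4's frame of record (binders VERBATIM as in ★ `exists_borelBound_frame` ∕ ★ `exists_lift_unipotent` ∕ ★ `hLD_CM`)
    [IsGalois F E] (h2 : ∀ σ : E ≃ₐ[F] E, σ = 1 ∨ σ = c) (hTW : TW 0 0 ≠ 0)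
    (hTs : (adelicGram F e TV TW).IsSymm)
    (u₀ : adelicMpCont F (Fin (n + n)) (doubledGramFin F (adelicGram F e TV TW)))
    (hu₀ : ∀ Ψ : piSchwartzBruhat F (Fin (n + n)),
      ((adelicMpCont.omega F (Fin (n + n)) (doubledGramFin F (adelicGram F e TV TW)) u₀ Ψ : piSchwartzBruhat F (Fin (n + n))) :
          (Fin (n + n) → AdeleRing (𝓞 F) F) → ℂ) =
        chirp F (ratMatrix F (frameHalfRat F)) (Ψ : (Fin (n + n) → AdeleRing (𝓞 F) F) → ℂ))
    (jS : ↥(UnitaryGroup.adelic F E c (1 + 1)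
        ((Matrix.reindex finSumFinEquiv finSumFinEquiv (Matrix.fromBlocks TW 0 0 (-TW))).map (algebraMap F E))) →*
      ↥(symplecticGroup (polar (Matrix.toLinearMap₂' (AdeleRing (𝓞 F) F)
        (Matrix.fromBlocks (adelicGram F e TV TW) 0 0 (-adelicGram F e TV TW))))))
    (hjS : ∀ (A : ↥(UnitaryGroup.adelic F E c (1 + 1)
        ((Matrix.reindex finSumFinEquiv finSumFinEquiv (Matrix.fromBlocks TW 0 0 (-TW))).map (algebraMap F E))))
        (v : (Fin (n + n) → AdeleRing (𝓞 F) F) × (Fin (n + n) → AdeleRing (𝓞 F) F)),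
      ((spReindex (finSumFinEquiv : Fin n ⊕ Fin n ≃ Fin (n + n))
          (Matrix.fromBlocks (adelicGram F e TV TW) 0 0 (-adelicGram F e TV TW)) (jS A) :
          symplecticGroup (polar (Matrix.toLinearMap₂' (AdeleRing (𝓞 F) F)
            (Matrix.reindex finSumFinEquiv finSumFinEquiv
              (Matrix.fromBlocks (adelicGram F e TV TW) 0 0 (-adelicGram F e TV TW)))))) :
        ((Fin (n + n) → AdeleRing (𝓞 F) F) × (Fin (n + n) → AdeleRing (𝓞 F) F)) ≃ₗ[AdeleRing (𝓞 F) F]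
          ((Fin (n + n) → AdeleRing (𝓞 F) F) × (Fin (n + n) → AdeleRing (𝓞 F) F))) v =
      ((toSp F E c N (1 + 1)
          (((Equiv.prodCongr (Equiv.refl (Fin N)) finSumFinEquiv.symm).trans (Equiv.prodSumDistrib (Fin N) (Fin 1) (Fin 1))).trans
            ((Equiv.sumCongr e e).trans finSumFinEquiv))
          (TV.map (algebraMap F E)) ((Matrix.reindex finSumFinEquiv finSumFinEquiv (Matrix.fromBlocks TW 0 0 (-TW))).map (algebraMap F E))
          hcδ hδ hd hV hW2 rfl rfl
          (adelicInr F E c N (1 + 1) (TV.map (algebraMap F E))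
            ((Matrix.reindex finSumFinEquiv finSumFinEquiv (Matrix.fromBlocks TW 0 0 (-TW))).map (algebraMap F E)) A) :
          symplecticGroup (polar (adelicForm F (Fin (n + n))
            (adelicGram F
              (((Equiv.prodCongr (Equiv.refl (Fin N)) finSumFinEquiv.symm).trans (Equiv.prodSumDistrib (Fin N) (Fin 1) (Fin 1))).trans
                ((Equiv.sumCongr e e).trans finSumFinEquiv)) TV
              (Matrix.reindex finSumFinEquiv finSumFinEquiv (Matrix.fromBlocks TW 0 0 (-TW))))))) :
        ((Fin (n + n) → AdeleRing (𝓞 F) F) × (Fin (n + n) → AdeleRing (𝓞 F) F)) ≃ₗ[AdeleRing (𝓞 F) F]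
          ((Fin (n + n) → AdeleRing (𝓞 F) F) × (Fin (n + n) → AdeleRing (𝓞 F) F))) v)
    (j : ↥(UnitaryGroup.adelic F E c (1 + 1)
        ((Matrix.reindex finSumFinEquiv finSumFinEquiv (Matrix.fromBlocks TW 0 0 (-TW))).map (algebraMap F E))) →*
      ↥(symplecticGroup (polar (adelicForm F (Fin (n + n)) (doubledGramFin F (adelicGram F e TV TW))))))
    (hj : j = (MulAut.conj (adelicMpCont.proj F (Fin (n + n)) (doubledGramFin F (adelicGram F e TV TW)) u₀ *
        adelicMpCont.proj F (Fin (n + n)) (doubledGramFin F (adelicGram F e TV TW))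
          (doublingDeltaLift F (adelicGram F e TV TW) (isUnit_det_adelicGram F e hVd hWd)))).toMonoidHom.comp
      ((spReindex (finSumFinEquiv : Fin n ⊕ Fin n ≃ Fin (n + n))
        (Matrix.fromBlocks (adelicGram F e TV TW) 0 0 (-adelicGram F e TV TW))).comp jS))
    {M : GL (Fin 2) (AdeleRing (𝓞 E) E)}
    (hM : (M : Matrix (Fin 2) (Fin 2) (AdeleRing (𝓞 E) E)) =
      !![1, algebraMap E (AdeleRing (𝓞 E) E) (algebraMap F E (2 * TW 0 0)⁻¹);
        1, -algebraMap E (AdeleRing (𝓞 E) E) (algebraMap F E (2 * TW 0 0)⁻¹)])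
    -- the functional `E″ = Λ_θ − ν(univ)·E_X` (as a `ℂ`-linear map) and (**)′ on the Borel, per `Φ` (★ A4's conclusion shape)
    (E'' : piSchwartzBruhat F (Fin (n + n)) →ₗ[ℂ] ℂ)
    (hE'' : ∀ Ψ : piSchwartzBruhat F (Fin (n + n)), E'' Ψ = thetaOrbitFunctional F E c hcδ hδ hd N e TV hV hVd TW hW hWd ν Ψ -
      ((ν Set.univ).toReal : ℂ) * adelicSiegelFunctionalC F (Fin (n + n)) νX h hh hB Ψ)
    (hBOUND : ∀ Φ : piSchwartzBruhat F (Fin (n + n)), ∃ Mbound : ℝ,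
      ∀ (p : adelicMpCont F (Fin (n + n)) (doubledGramFin F (adelicGram F e TV TW))) (b : GL (Fin (1 + 1)) (AdeleRing (𝓞 E) E))
        (hb : b ∈ UnitaryGroup.adelic F E c (1 + 1)
        ((Matrix.reindex finSumFinEquiv finSumFinEquiv (Matrix.fromBlocks TW 0 0 (-TW))).map (algebraMap F E))),
        (b : Matrix (Fin (1 + 1)) (Fin (1 + 1)) (AdeleRing (𝓞 E) E)) 0 0 + (b : Matrix (Fin (1 + 1)) (Fin (1 + 1)) (AdeleRing (𝓞 E) E)) 0 1 =
          (b : Matrix (Fin (1 + 1)) (Fin (1 + 1)) (AdeleRing (𝓞 E) E)) 1 0 + (b : Matrix (Fin (1 + 1)) (Fin (1 + 1)) (AdeleRing (𝓞 E) E)) 1 1 →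
        adelicMpCont.proj F (Fin (n + n)) (doubledGramFin F (adelicGram F e TV TW)) p = j ⟨b, hb⟩ →
        ‖E'' (adelicMpCont.omega F (Fin (n + n)) (doubledGramFin F (adelicGram F e TV TW)) p Φ)‖ ≤
          Mbound * Real.sqrt (adelicMpCont.l2Scaling F (doubledGramFin F (adelicGram F e TV TW))
            (isUnit_det_doubledGramFin F (adelicGram F e TV TW) (isUnit_det_adelicGram F e hVd hWd)) νX p).toReal)
    -- the split place `v` (`sd ² = d` in `F_v`) with a Haar measure on `F_v`
    (v : HeightOneSpectrum (𝓞 F)) {sd : v.adicCompletion F} (hs : sd * sd = algebraMap F (v.adicCompletion F) d)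
    [MeasurableSpace (v.adicCompletion F)] [BorelSpace (v.adicCompletion F)]
    (μK : Measure (v.adicCompletion F)) [μK.IsAddHaarMeasure]
    -- (S-3E) the `E`-side coordinate-hyperplane nulls at `v` (A-p08's shape, as consumed by ★ `exists_frame_identityClose_triples_all₃`)
    (hS3E : ∀ β : (Fin (n + n) → v.adicCompletion F) ≃ₗ[v.adicCompletion F]
        ((Fin n → v.adicCompletion F) × (Fin n → v.adicCompletion F)),
      (∀ x : Fin (n + n) → AdeleRing (𝓞 F) F,
        AdelicGroupData.adeleEval F v (hNorm F E c hcδ hδ N e TV hVd TW hWd x) =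
          (β (evalAt F (Fin (n + n)) v x)).1 ⬝ᵥ (β (evalAt F (Fin (n + n)) v x)).2) →
      (∃ cst : ℝ≥0, 0 < cst ∧
        Measure.map β (Measure.pi fun _ : Fin (n + n) => μK) =
          (cst : ℝ≥0∞) • ((Measure.pi fun _ : Fin n => μK).prod (Measure.pi fun _ : Fin n => μK))) →
      adelicSiegelMeasure F (Fin (n + n)) νX h hh hB {x | (β (evalAt F (Fin (n + n)) v x)).1 = 0} = 0 ∧
        adelicSiegelMeasure F (Fin (n + n)) νX h hh hB {x | (β (evalAt F (Fin (n + n)) v x)).2 = 0} = 0)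
    -- (ζ) the one-place torus ideles at `v` (A-p01's shape, as consumed by ★ `hLD_CM`)
    (hIDL : ∀ r : v.adicCompletion F, r ≠ 0 →
      ∃ (t : (AdeleRing (𝓞 E) E)ˣ) (p₂ q₂ : AdeleRing (𝓞 F) F) (a b : v.adicCompletion F),
        QuadraticCoordinates.re (quadraticAdeleEquiv F E c hcδ hδ).toAddEquiv (UnitaryGroup.conjAdele F E c (t : AdeleRing (𝓞 E) E)) = p₂ ∧
        QuadraticCoordinates.im (quadraticAdeleEquiv F E c hcδ hδ).toAddEquiv (UnitaryGroup.conjAdele F E c (t : AdeleRing (𝓞 E) E)) = q₂ ∧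
        AdelicGroupData.adeleEval F v p₂ = a ∧ AdelicGroupData.adeleEval F v q₂ = b ∧ a + sd * b = r ∧ a - sd * b = 1 ∧
        (∀ z : AdeleRing (𝓞 F) F, AdelicGroupData.adeleEval F v z = 0 → p₂ * z = z) ∧
        (∀ z : AdeleRing (𝓞 F) F, AdelicGroupData.adeleEval F v z = 0 → q₂ * z = 0) ∧
        p₂ * p₂ - algebraMap F (AdeleRing (𝓞 F) F) d * (q₂ * q₂) = 1 - adeleSingleHom F v 1 + adeleSingleHom F v r ∧
        ∃ p₂' q₂' : AdeleRing (𝓞 F) F, p₂ * p₂' + algebraMap F (AdeleRing (𝓞 F) F) d * (q₂ * q₂') = 1 ∧ p₂ * q₂' + q₂ * p₂' = 0) :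
    ∀ (b : F) (Θ : piSchwartzBruhatReal F (Fin (n + n))), 0 ≤ (Θ : (Fin (n + n) → AdeleRing (𝓞 F) F) → ℝ) →
      HasCompactSupport (Θ : (Fin (n + n) → AdeleRing (𝓞 F) F) → ℝ) →
      ∫ x, (Θ : (Fin (n + n) → AdeleRing (𝓞 F) F) → ℝ) x ∂(fibreMeasure F (Fin (n + n)) (thetaOrbitFunctionalReal F E c hcδ hδ hd N e TV hV hVd TW hW hWd ν)
          (thetaOrbitFunctionalReal_nonneg F E c hcδ hδ hd N e TV hV hVd TW hW hWd ν) h b) =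
        (ν Set.univ).toReal * ∫ x, (Θ : (Fin (n + n) → AdeleRing (𝓞 F) F) → ℝ) x ∂(adelicSiegelFibreMeasure F (Fin (n + n)) νX h hh hB b) := by
  intro b Θ h0 hc
  -- `n = N ≥ 3`
  have hNn : N = n := by simpa [Fintype.card_prod, Fintype.card_fin] using Fintype.card_congr e
  have hκ : 3 ≤ Fintype.card (Fin n) := by rw [Fintype.card_fin]; omega
  haveI : Nonempty (Fin n) := ⟨⟨0, by omega⟩⟩
  -- A-p01's formula frame `β` (★ `exists_splitPlaceFrame₃`) and B-p02's frame + triples for every `b` on it (★ `_all₃`)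
  obtain ⟨β, hβ, -, -, -, -, -⟩ := E2SWSplitPlaceFrame.exists_splitPlaceFrame₃ F E c hcδ hδ hd N e TV hV hVd TW hW hWd v hs μK
  obtain ⟨βv, fr, he1, he2, -, H₁, H₂, hβv⟩ :=
    E2SWIdentityCloseTriplesAllFormulaCM.exists_frame_identityClose_triples_all₃ F E c hcδ hδ hd N e TV hV hVd TW hW hWd ν νX h hh v μK
      hhN hB hs τ hτ hS3E
  -- the unipotent letter (★ A5) and the Levi letter (★ (S-1) `hLD_CM`, on the same frame: `βv = β` pointwise by the two formulas)
  have hLN := fun β' : AdeleRing (𝓞 F) F =>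
    E2SWBorelBoundFrameUnip.exists_lift_unipotent F E c hcδ hδ hd N e TW hV hW2 hVd hWd hTW νX u₀ hu₀ jS hjS j hj β'
  have hLD := E2SWDilateBoundCM.hLD_CM F E c hcδ hδ hd N e TV hV hVd TW hW hWd hW2 νX v h2 hTW hTs u₀ hu₀ jS hjS j hj hM hs β hβ βv fr
    he1 he2 (fun y => (hβv y).trans (hβ y).symm) hIDL
  -- ★ (T4) with everything above plugged in (`K := F_v`, `κ := Fin n`, `𝕋 := doubledGramFin (adelicGram)`, `Smat := ratMatrix C₀`)
  exact E2SWIdentityCloseFibreCM.hfib_CM_of F E c hcδ hδ hd N e TV hV hVd TW hW hWd ν νX h hh hhN hB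
    (ratMatrix F (Matrix.reindex finSumFinEquiv finSumFinEquiv
      (Matrix.fromBlocks (UnitaryDualPair.gram F e TV TW) 0 0 (-(d • (UnitaryDualPair.gram F e TV TW)⁻¹)))))
    (fun x => (hhN x).trans (UnitaryDoubling.hNorm_eq_sdForm_C0 F E c hcδ hδ hd N e TV hVd TW hWd x))
    (doubledGramFin F (adelicGram F e TV TW))
    (isUnit_det_doubledGramFin F (adelicGram F e TV TW) (isUnit_det_adelicGram F e hVd hWd))
    j E'' hE'' hBOUND hLN v μK hκ βv fr he1 he2 hLD (fun b => (b : v.adicCompletion F)) H₁ H₂ b Θ h0 hc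

end Main

end Summit.HodgeConjecture.HodgeConjecture.Cruxes.H413.E2SWIdentityCloseFibreCMFrame

end
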